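import Literature.MathematicalPhysics.QuantumLattice.FermionOperatorsProofs
import Literature.MathematicalPhysics.QuantumLattice.HubbardLiebBasis
import HarnessLib

/-!
# Fermionic trace factorisation: words in Jordan–Wigner operators, CAR subalgebras, product traces

For the concrete Jordan–Wigner model of the tree (`HubbardWave0`: `Fock ι = Finset ι → ℂ`,
`annihilation i`, `creation i = (annihilation i)ᴴ`, `jwSign i s = (-1)^{#{j ∈ s | j < i}}`) we prove
the **factorisation of the normalised trace over the CAR subalgebras of disjoint orbital sets**:
if `a` lies in the subalgebra generated by `{c_i, c†_i : i ∈ S₁}` and `b` in that of `S₂`,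
`S₁ ∩ S₂ = ∅`, then `Tr(ab) · Tr(1) = Tr(a) · Tr(b)` (`trace_mul_of_mem_carSubalgebra`), together
with the **graded commutativity**: elements of the EVEN subalgebra of `S₁` (generated by products
of two generators) commute with the whole subalgebra of `S₂`
(`commute_of_mem_carEvenSubalgebra`). These are the two algebraic facts behind the polymer
(cluster) representation of `tr e^{-βH}` for lattice fermion Hamiltonians `H = Σ_X H_X` with even
local terms (Ueltschi 1999 §2.1 "factorization properties" of a "quantum interaction"; Bratteli–
Robinson II §5.2.2, the CAR algebra as a graded tensor product / product property of the trace
state), which in the Jordan–Wigner MATRIX picture is not a literal tensor factorisation (the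
hopping `c†_x c_y` carries a Jordan–Wigner string between `x` and `y`).

## Method (finite combinatorics of words)

A word `w` (list of letters `(i, create?)`) acts on the occupation basis vector `|u⟩` by
`w|u⟩ = wordCoeff w u · |wordSet w u⟩` (`wordOp_mulVec_single`); for letters in `S` and
`u = a ⊔ e` with `a ⊆ S`, `e ∩ S = ∅`: `wordSet w u = wordSet w a ⊔ e` and
`wordCoeff w u = wordCoeff w a · extSign w e`, `extSign w e = Π_{letters} σ_i(e)` (the Jordan–Wigner
signs are multiplicative over disjoint unions, `jwSign_union`). The KEY cancellation
(`extSign_eq_one_of_wordSet_eq`): along the word every orbital `i` has its occupancy toggled once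
per letter at `i`, so `extSign w e` is the product of `σ_i(e)` over the orbitals whose occupancy
differs between `a` and `wordSet w a`; for a DIAGONAL contribution (`wordSet w a = a`) it is `1`.
Hence the diagonal matrix element `⟨u|w|u⟩` only depends on `u ∩ S`, and the traces of products of
words with disjoint supports factorise by summing over `u ↔ (u ∩ S₁, u ∩ S₂, rest)`. Linear
extension to the spans of words (= `Algebra.adjoin`, `Algebra.adjoin_eq_span`) gives the
subalgebra statements. Everything is PROVED; no `sorry`, no new axioms.

## References

* D. Ueltschi, J. Stat. Phys. 95 (1999) 693, §2.1 (quantum interactions, factorisation). [Ueltschi1999]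
* O. Bratteli, D. W. Robinson, *Operator Algebras and Quantum Statistical Mechanics II*, §5.2.2. [BratteliRobinsonII1997]
-/

noncomputable section

namespace Literature.MathematicalPhysics.QuantumLattice

open Matrix Finset HubbardWave0 LiebTwo

variable {ι : Type*} [LinearOrder ι]

/-! ### Letters and words -/

/-- A letter: an orbital and a flag, `true` = creation `c†_i`, `false` = annihilation `c_i`.
[folklore] -/
abbrev JWLetter (ι : Type*) : Type _ := ι × Bool

section Action

variable [Fintype ι]

/-- The operator of a letter. [folklore] -/
def letterOp (l : JWLetter ι) : Matrix (Finset ι) (Finset ι) ℂ :=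
  if l.2 then creation l.1 else annihilation l.1

/-- The operator of a word: the ordered product of its letters (leftmost letter acts last).
[folklore] -/
def wordOp (w : List (JWLetter ι)) : Matrix (Finset ι) (Finset ι) ℂ := (w.map letterOp).prod

/-- `wordOp [] = 1`. [folklore] -/
@[simp] theorem wordOp_nil : wordOp ([] : List (JWLetter ι)) = 1 := by simp [wordOp]

/-- `wordOp (l :: w) = letterOp l * wordOp w`. [folklore] -/
theorem wordOp_cons (l : JWLetter ι) (w : List (JWLetter ι)) : wordOp (l :: w) = letterOp l * wordOp w := by
  simp [wordOp]

/-- `wordOp (w₁ ++ w₂) = wordOp w₁ * wordOp w₂`. [folklore] -/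
theorem wordOp_append (w₁ w₂ : List (JWLetter ι)) : wordOp (w₁ ++ w₂) = wordOp w₁ * wordOp w₂ := by
  simp [wordOp, List.prod_append]

end Action

/-- The occupation set after applying a letter (meaningful when the coefficient is non-zero).
[folklore] -/
def letterSet (l : JWLetter ι) (u : Finset ι) : Finset ι := if l.2 then insert l.1 u else u.erase l.1

/-- The coefficient of a letter on an occupation basis vector: `c†_i|u⟩ = [i ∉ u] σ_i(u) |u ∪ i⟩`,
`c_i|u⟩ = [i ∈ u] σ_i(u) |u ∖ i⟩`. [folklore] -/
def letterCoeff (l : JWLetter ι) (u : Finset ι) : ℂ :=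
  if l.2 then (if l.1 ∈ u then 0 else jwSign l.1 u) else (if l.1 ∈ u then jwSign l.1 u else 0)

/-- The occupation set after applying a word. [folklore] -/
def wordSet : List (JWLetter ι) → Finset ι → Finset ι
  | [], u => u
  | l :: w, u => letterSet l (wordSet w u)

/-- The coefficient of a word on an occupation basis vector. [folklore] -/
def wordCoeff : List (JWLetter ι) → Finset ι → ℂ
  | [], _ => 1
  | l :: w, u => letterCoeff l (wordSet w u) * wordCoeff w u

/-- The external Jordan–Wigner sign of a word relative to a set `e` of "spectator" orbitals:
`Π_{letters (i, ·)} σ_i(e)`. [folklore] -/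
def extSign (w : List (JWLetter ι)) (e : Finset ι) : ℂ := (w.map fun l => jwSign l.1 e).prod

/-- The diagonal coefficient `⟨u| w |u⟩`. [folklore] -/
def diagCoeff (w : List (JWLetter ι)) (u : Finset ι) : ℂ := if wordSet w u = u then wordCoeff w u else 0

/-- All letters of the word have orbitals in `S`. [folklore] -/
def LettersIn (S : Finset ι) (w : List (JWLetter ι)) : Prop := ∀ l ∈ w, l.1 ∈ S

omit [LinearOrder ι] in
/-- `LettersIn` for a cons. [folklore] -/
theorem lettersIn_cons {S : Finset ι} {l : JWLetter ι} {w : List (JWLetter ι)} :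
    LettersIn S (l :: w) ↔ l.1 ∈ S ∧ LettersIn S w := by
  simp [LettersIn]

omit [LinearOrder ι] in
/-- `LettersIn` for an append. [folklore] -/
theorem lettersIn_append {S : Finset ι} {w₁ w₂ : List (JWLetter ι)} :
    LettersIn S (w₁ ++ w₂) ↔ LettersIn S w₁ ∧ LettersIn S w₂ := by
  simp only [LettersIn, List.mem_append]
  exact ⟨fun h => ⟨fun l hl => h l (Or.inl hl), fun l hl => h l (Or.inr hl)⟩,
    fun h l hl => hl.elim (h.1 l) (h.2 l)⟩

omit [LinearOrder ι] in
/-- `LettersIn` is monotone in the orbital set. [folklore] -/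
theorem LettersIn.mono {S T : Finset ι} (hST : S ⊆ T) {w : List (JWLetter ι)} (h : LettersIn S w) :
    LettersIn T w := fun l hl => hST (h l hl)

/-! ### Action of letters and words on the occupation basis -/

section Action

variable [Fintype ι]

/-- A letter acts on a basis vector by its coefficient and its set move. [folklore] -/
theorem letterOp_mulVec_single (l : JWLetter ι) (u : Finset ι) :
    letterOp l *ᵥ Pi.single u (1 : ℂ) = letterCoeff l u • Pi.single (letterSet l u) 1 := by
  obtain ⟨i, b⟩ := l
  cases b
  · simp only [letterOp, letterCoeff, letterSet, if_false, Bool.false_eq_true]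
    rw [annihilation_mulVec_single]
    split_ifs <;> simp
  · simp only [letterOp, letterCoeff, letterSet, if_true]
    rw [FermionOperatorsProofs.creation_mulVec_single]
    split_ifs <;> simp

/-- **A word acts on a basis vector by its coefficient and its set move**:
`w|u⟩ = wordCoeff w u · |wordSet w u⟩`. [folklore] -/
theorem wordOp_mulVec_single (w : List (JWLetter ι)) (u : Finset ι) :
    wordOp w *ᵥ Pi.single u (1 : ℂ) = wordCoeff w u • Pi.single (wordSet w u) 1 := by
  induction w with
  | nil =>
    rw [wordOp_nil, one_mulVec]
    simp [wordSet, wordCoeff]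
  | cons l w ih =>
    rw [wordOp_cons, ← mulVec_mulVec, ih, mulVec_smul, letterOp_mulVec_single, smul_smul]
    simp only [wordCoeff, wordSet, mul_comm]

/-- The diagonal matrix element of a word: `⟨u|w|u⟩ = diagCoeff w u`. [folklore] -/
theorem wordOp_apply_self (w : List (JWLetter ι)) (u : Finset ι) : wordOp w u u = diagCoeff w u := by
  have h := congrFun (wordOp_mulVec_single w u) u
  rw [mulVec_single_one, col_apply] at h
  rw [h, diagCoeff, Pi.smul_apply, smul_eq_mul]
  by_cases hu : wordSet w u = u
  · rw [if_pos hu, hu]; simp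
  · rw [if_neg hu, Pi.single_eq_of_ne (Ne.symm hu)]; simp

/-- The trace of a word is the sum of its diagonal coefficients. [folklore] -/
theorem trace_wordOp (w : List (JWLetter ι)) : (wordOp w).trace = ∑ u, diagCoeff w u := by
  simp only [Matrix.trace, Matrix.diag]
  exact Finset.sum_congr rfl fun u _ => wordOp_apply_self w u

end Action

/-! ### Locality: spectator orbitals only contribute a multiplicative external sign -/

section Locality

variable {S : Finset ι}

/-- `extSign` of the empty word. [folklore] -/
@[simp] theorem extSign_nil (e : Finset ι) : extSign ([] : List (JWLetter ι)) e = 1 := by simp [extSign]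

/-- `extSign` of a cons. [folklore] -/
theorem extSign_cons (l : JWLetter ι) (w : List (JWLetter ι)) (e : Finset ι) :
    extSign (l :: w) e = jwSign l.1 e * extSign w e := by
  simp [extSign]

/-- `extSign` never vanishes (it is a product of signs). [folklore] -/
theorem extSign_ne_zero (w : List (JWLetter ι)) (e : Finset ι) : extSign w e ≠ 0 := by
  induction w with
  | nil => simp
  | cons l w ih => rw [extSign_cons]; exact mul_ne_zero (jwSign_ne_zero _ _) ih

/-- A letter in `S` moves a set `a ⊔ e` (`a ⊆ S`, `e` disjoint from `S`) to `(moved a) ⊔ e`.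
[folklore] -/
theorem letterSet_union {l : JWLetter ι} (hl : l.1 ∈ S) (a : Finset ι) {e : Finset ι}
    (he : Disjoint e S) : letterSet l (a ∪ e) = letterSet l a ∪ e := by
  have hle : l.1 ∉ e := fun h => Finset.disjoint_left.1 he h hl
  unfold letterSet
  split_ifs
  · rw [Finset.insert_union]
  · rw [Finset.erase_union_distrib, Finset.erase_eq_of_notMem hle]

/-- A letter in `S` keeps subsets of `S` inside `S`. [folklore] -/
theorem letterSet_subset {l : JWLetter ι} (hl : l.1 ∈ S) {a : Finset ι} (ha : a ⊆ S) :
    letterSet l a ⊆ S := by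
  unfold letterSet
  split_ifs
  · exact Finset.insert_subset hl ha
  · exact (Finset.erase_subset _ _).trans ha

/-- The coefficient of a letter in `S` on `a ⊔ e` is its coefficient on `a` times the spectator
sign `σ_i(e)` (`jwSign_union`). [folklore] -/
theorem letterCoeff_union {l : JWLetter ι} (hl : l.1 ∈ S) {a e : Finset ι} (ha : a ⊆ S)
    (he : Disjoint e S) : letterCoeff l (a ∪ e) = letterCoeff l a * jwSign l.1 e := by
  have hle : l.1 ∉ e := fun h => Finset.disjoint_left.1 he h hl
  have hae : Disjoint a e := Finset.disjoint_of_subset_left ha he.symm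
  have hmem : l.1 ∈ a ∪ e ↔ l.1 ∈ a := by simp [hle]
  unfold letterCoeff
  simp only [hmem, jwSign_union hae]
  split_ifs <;> ring

/-- **Locality of the set move**: a word with letters in `S` moves `a ⊔ e` to `(moved a) ⊔ e`,
and keeps subsets of `S` inside `S`. [folklore] -/
theorem wordSet_union (w : List (JWLetter ι)) (hw : LettersIn S w) {a e : Finset ι} (ha : a ⊆ S)
    (he : Disjoint e S) : wordSet w (a ∪ e) = wordSet w a ∪ e ∧ wordSet w a ⊆ S := by
  induction w with
  | nil => exact ⟨rfl, ha⟩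
  | cons l w ih =>
    obtain ⟨hl, hw'⟩ := lettersIn_cons.1 hw
    obtain ⟨ih1, ih2⟩ := ih hw'
    refine ⟨?_, ?_⟩
    · show letterSet l (wordSet w (a ∪ e)) = letterSet l (wordSet w a) ∪ e
      rw [ih1, letterSet_union hl _ he]
    · exact letterSet_subset hl ih2

/-- **Locality of the coefficient**: for a word with letters in `S`,
`wordCoeff w (a ⊔ e) = wordCoeff w a · extSign w e`. [folklore] -/
theorem wordCoeff_union (w : List (JWLetter ι)) (hw : LettersIn S w) {a e : Finset ι} (ha : a ⊆ S)
    (he : Disjoint e S) : wordCoeff w (a ∪ e) = wordCoeff w a * extSign w e := by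
  induction w with
  | nil => simp [wordCoeff]
  | cons l w ih =>
    obtain ⟨hl, hw'⟩ := lettersIn_cons.1 hw
    obtain ⟨hset, hsub⟩ := wordSet_union w hw' ha he
    show letterCoeff l (wordSet w (a ∪ e)) * wordCoeff w (a ∪ e) =
      letterCoeff l (wordSet w a) * wordCoeff w a * extSign (l :: w) e
    rw [hset, letterCoeff_union hl hsub he, ih hw', extSign_cons]
    ring

/-- Membership after a letter with non-zero coefficient is toggled exactly at its orbital.
[folklore] -/
theorem mem_letterSet_iff_of_ne_zero {l : JWLetter ι} {v : Finset ι} (hne : letterCoeff l v ≠ 0)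
    (i : ι) : (i ∈ letterSet l v ↔ i ∈ v) ↔ i ≠ l.1 := by
  unfold letterCoeff at hne
  unfold letterSet
  split_ifs at hne ⊢ with hb h1 h2
  · exact absurd rfl hne
  · rw [Finset.mem_insert]
    constructor
    · rintro h rfl; exact h1 (h.1 (Or.inl rfl))
    · intro h; exact ⟨fun h' => h'.resolve_left h, Or.inr⟩
  · rw [Finset.mem_erase]
    constructor
    · rintro h rfl; exact (h.2 h2).1 rfl
    · intro h; exact ⟨And.right, fun h' => ⟨h, h'⟩⟩
  · exact absurd rfl hne

/-- **The key cancellation**: for a word with letters in `S` and non-zero coefficient on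
`a ⊆ S`, the spectator sign `extSign w e` is the product of `σ_i(e)` over the orbitals `i ∈ S`
whose occupancy differs between `a` and `wordSet w a` (each letter toggles the occupancy of its
orbital and contributes one factor `σ_i(e)`, and `σ_i(e)² = 1`). [folklore] -/
theorem extSign_eq_prod_toggle (w : List (JWLetter ι)) (hw : LettersIn S w) {a : Finset ι}
    (hne : wordCoeff w a ≠ 0) (e : Finset ι) :
    extSign w e = ∏ i ∈ S, (if (i ∈ wordSet w a ↔ i ∈ a) then (1 : ℂ) else jwSign i e) := by
  induction w with
  | nil => simp [wordSet]
  | cons l w ih =>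
    obtain ⟨hl, hw'⟩ := lettersIn_cons.1 hw
    have hne' : letterCoeff l (wordSet w a) ≠ 0 ∧ wordCoeff w a ≠ 0 := by
      rwa [wordCoeff, mul_ne_zero_iff] at hne
    rw [extSign_cons, ih hw' hne'.2]
    -- split off the factor at `j = l.1`
    rw [← Finset.mul_prod_erase S _ hl, ← Finset.mul_prod_erase S _ hl, ← mul_assoc]
    have htog := mem_letterSet_iff_of_ne_zero hne'.1
    congr 1
    · -- the factor at `j` flips
      have hj : (l.1 ∈ wordSet (l :: w) a ↔ l.1 ∈ a) ↔ ¬ (l.1 ∈ wordSet w a ↔ l.1 ∈ a) := by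
        have h1 : ¬ (l.1 ∈ letterSet l (wordSet w a) ↔ l.1 ∈ wordSet w a) :=
          fun h => (htog l.1).1 h rfl
        show (l.1 ∈ letterSet l (wordSet w a) ↔ l.1 ∈ a) ↔ _
        tauto
      by_cases hc : (l.1 ∈ wordSet w a ↔ l.1 ∈ a)
      · rw [if_pos hc, if_neg (hj.not.2 (not_not_intro hc)), mul_one]
      · rw [if_neg hc, if_pos (hj.2 hc), jwSign_mul_self]
    · -- the other factors are unchanged
      refine Finset.prod_congr rfl fun i hi => ?_
      have hij : i ≠ l.1 := Finset.ne_of_mem_erase hi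
      have hi' : (i ∈ letterSet l (wordSet w a) ↔ i ∈ wordSet w a) := (htog i).2 hij
      show (if (i ∈ wordSet w a ↔ i ∈ a) then (1 : ℂ) else jwSign i e) =
        (if (i ∈ letterSet l (wordSet w a) ↔ i ∈ a) then (1 : ℂ) else jwSign i e)
      simp only [hi']

/-- For a DIAGONAL contribution (`wordSet w a = a`, non-zero coefficient) the spectator sign is
`1`: **the diagonal matrix elements of a word do not feel the Jordan–Wigner strings of the
spectators**. [folklore] -/
theorem extSign_eq_one_of_wordSet_eq (w : List (JWLetter ι)) (hw : LettersIn S w) {a : Finset ι}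
    (hfix : wordSet w a = a) (hne : wordCoeff w a ≠ 0) (e : Finset ι) : extSign w e = 1 := by
  rw [extSign_eq_prod_toggle w hw hne e]
  exact Finset.prod_eq_one fun i _ => by rw [hfix, if_pos Iff.rfl]

/-- The diagonal coefficient on `a ⊔ e` equals the one on `a` (spectators drop out). [folklore] -/
theorem diagCoeff_union (w : List (JWLetter ι)) (hw : LettersIn S w) {a e : Finset ι} (ha : a ⊆ S)
    (he : Disjoint e S) : diagCoeff w (a ∪ e) = diagCoeff w a := by
  obtain ⟨hset, hsub⟩ := wordSet_union w hw ha he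
  unfold diagCoeff
  rw [hset, wordCoeff_union w hw ha he]
  have hiff : wordSet w a ∪ e = a ∪ e ↔ wordSet w a = a := by
    constructor
    · intro h
      have h1 : (wordSet w a ∪ e) ∩ S = (a ∪ e) ∩ S := by rw [h]
      rwa [Finset.union_inter_distrib_right, Finset.union_inter_distrib_right,
        Finset.disjoint_iff_inter_eq_empty.1 he, Finset.union_empty, Finset.union_empty,
        Finset.inter_eq_left.2 hsub, Finset.inter_eq_left.2 ha] at h1
    · intro h; rw [h]
  by_cases hfix : wordSet w a = a
  · rw [if_pos (hiff.2 hfix), if_pos hfix]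
    by_cases hne : wordCoeff w a = 0
    · rw [hne, zero_mul]
    · rw [extSign_eq_one_of_wordSet_eq w hw hfix hne e, mul_one]
  · rw [if_neg (fun h => hfix (hiff.1 h)), if_neg hfix]

/-- **The diagonal matrix element of a word with letters in `S` only depends on `u ∩ S`.**
[folklore] -/
theorem diagCoeff_eq_diagCoeff_inter (w : List (JWLetter ι)) (hw : LettersIn S w) (u : Finset ι) :
    diagCoeff w u = diagCoeff w (u ∩ S) := by
  have hu : u ∩ S ∪ u \ S = u := sup_inf_sdiff u S
  conv_lhs => rw [← hu]
  exact diagCoeff_union w hw Finset.inter_subset_right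
    (Finset.disjoint_left.2 fun i hi hiS => (Finset.mem_sdiff.1 hi).2 hiS)

end Locality

/-! ### Traces of words and their factorisation over disjoint supports -/

section Traces

variable [Fintype ι]

/-- Summing a function of `u ∩ S` over all `u`: each `a ⊆ S` has `2^{|ι| - |S|}` preimages.
[folklore] -/
theorem sum_univ_apply_inter_eq (S : Finset ι) (g : Finset ι → ℂ) :
    ∑ u : Finset ι, g (u ∩ S) = 2 ^ (Fintype.card ι - S.card) * ∑ a ∈ S.powerset, g a := by
  have hre : ∑ u : Finset ι, g (u ∩ S) = ∑ p ∈ S.powerset ×ˢ Sᶜ.powerset, g p.1 := by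
    refine Finset.sum_nbij' (fun u => (u ∩ S, u \ S)) (fun p => p.1 ∪ p.2) ?_ ?_ ?_ ?_ ?_
    · intro u _
      refine Finset.mem_product.2 ⟨Finset.mem_powerset.2 Finset.inter_subset_right,
        Finset.mem_powerset.2 fun x hx => ?_⟩
      exact Finset.mem_compl.2 (Finset.mem_sdiff.1 hx).2
    · intro p _; exact Finset.mem_univ _
    · intro u _; exact sup_inf_sdiff u S
    · intro p hp
      obtain ⟨h1, h2⟩ := Finset.mem_product.1 hp
      have h1' : p.1 ⊆ S := Finset.mem_powerset.1 h1
      have h2' : Disjoint p.2 S := Finset.disjoint_left.2 fun x hx hxS =>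
        Finset.mem_compl.1 (Finset.mem_powerset.1 h2 hx) hxS
      ext <;> simp only
      · rw [Finset.union_inter_distrib_right, Finset.inter_eq_left.2 h1',
          Finset.disjoint_iff_inter_eq_empty.1 h2', Finset.union_empty]
      · rw [Finset.union_sdiff_distrib, Finset.sdiff_eq_empty_iff_subset.2 h1', Finset.empty_union,
          Finset.sdiff_eq_self_of_disjoint h2']
    · intro u _; rfl
  rw [hre, Finset.sum_product, Finset.mul_sum]
  refine Finset.sum_congr rfl fun a _ => ?_
  simp only [Finset.sum_const, Finset.card_powerset, Finset.card_compl, nsmul_eq_mul]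
  push_cast
  ring

variable {S S₁ S₂ : Finset ι}

/-- **The trace of a word with letters in `S`** is `2^{|ι| - |S|}` times the sum of its diagonal
coefficients over the subsets of `S`. [folklore] -/
theorem trace_wordOp_eq (w : List (JWLetter ι)) (hw : LettersIn S w) :
    (wordOp w).trace = 2 ^ (Fintype.card ι - S.card) * ∑ a ∈ S.powerset, diagCoeff w a := by
  rw [trace_wordOp, ← sum_univ_apply_inter_eq S (diagCoeff w)]
  exact Finset.sum_congr rfl fun u _ => diagCoeff_eq_diagCoeff_inter w hw u

omit [Fintype ι] in
/-- Set move of a concatenation. [folklore] -/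
theorem wordSet_append (w₁ w₂ : List (JWLetter ι)) (u : Finset ι) :
    wordSet (w₁ ++ w₂) u = wordSet w₁ (wordSet w₂ u) := by
  induction w₁ with
  | nil => rfl
  | cons l w ih => show letterSet l (wordSet (w ++ w₂) u) = letterSet l (wordSet w (wordSet w₂ u)); rw [ih]

omit [Fintype ι] in
/-- Coefficient of a concatenation. [folklore] -/
theorem wordCoeff_append (w₁ w₂ : List (JWLetter ι)) (u : Finset ι) :
    wordCoeff (w₁ ++ w₂) u = wordCoeff w₁ (wordSet w₂ u) * wordCoeff w₂ u := by
  induction w₁ with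
  | nil => simp [wordCoeff]
  | cons l w ih =>
    show letterCoeff l (wordSet (w ++ w₂) u) * wordCoeff (w ++ w₂) u =
      letterCoeff l (wordSet w (wordSet w₂ u)) * wordCoeff w (wordSet w₂ u) * wordCoeff w₂ u
    rw [wordSet_append, ih, mul_assoc]

omit [Fintype ι] [LinearOrder ι] in
/-- Unions of parts of two disjoint sets agree iff the parts agree. [folklore] -/
theorem union_eq_union_iff_of_subset [DecidableEq ι] {X a Y b S₁ S₂ : Finset ι} (hX : X ⊆ S₁) (ha : a ⊆ S₁)
    (hY : Y ⊆ S₂) (hb : b ⊆ S₂) (hS : Disjoint S₁ S₂) : X ∪ Y = a ∪ b ↔ X = a ∧ Y = b := by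
  constructor
  · intro h
    have hXY : Disjoint X S₂ := Finset.disjoint_of_subset_left hX hS
    have haS : Disjoint a S₂ := Finset.disjoint_of_subset_left ha hS
    have hYS : Disjoint Y S₁ := Finset.disjoint_of_subset_left hY hS.symm
    have hbS : Disjoint b S₁ := Finset.disjoint_of_subset_left hb hS.symm
    constructor
    · have h1 : (X ∪ Y) ∩ S₁ = (a ∪ b) ∩ S₁ := by rw [h]
      rwa [Finset.union_inter_distrib_right, Finset.union_inter_distrib_right,
        Finset.inter_eq_left.2 hX, Finset.inter_eq_left.2 ha,
        Finset.disjoint_iff_inter_eq_empty.1 hYS, Finset.disjoint_iff_inter_eq_empty.1 hbS,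
        Finset.union_empty, Finset.union_empty] at h1
    · have h1 : (X ∪ Y) ∩ S₂ = (a ∪ b) ∩ S₂ := by rw [h]
      rwa [Finset.union_inter_distrib_right, Finset.union_inter_distrib_right,
        Finset.inter_eq_left.2 hY, Finset.inter_eq_left.2 hb,
        Finset.disjoint_iff_inter_eq_empty.1 hXY, Finset.disjoint_iff_inter_eq_empty.1 haS,
        Finset.empty_union, Finset.empty_union] at h1
  · rintro ⟨rfl, rfl⟩; rfl

omit [Fintype ι] in
/-- **Diagonal coefficients of a product of words with disjoint supports factorise.**
[folklore] -/
theorem diagCoeff_append (w₁ w₂ : List (JWLetter ι)) (h1 : LettersIn S₁ w₁) (h2 : LettersIn S₂ w₂)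
    (hS : Disjoint S₁ S₂) {a b : Finset ι} (ha : a ⊆ S₁) (hb : b ⊆ S₂) :
    diagCoeff (w₁ ++ w₂) (a ∪ b) = diagCoeff w₁ a * diagCoeff w₂ b := by
  have haS : Disjoint a S₂ := Finset.disjoint_of_subset_left ha hS
  -- the action of `w₂` on `b ⊔ a`
  obtain ⟨hset2, hsub2⟩ := wordSet_union w₂ h2 hb haS
  have hcoef2 := wordCoeff_union w₂ h2 hb haS
  -- the action of `w₁` on `a ⊔ wordSet w₂ b`
  have hXS : Disjoint (wordSet w₂ b) S₁ := Finset.disjoint_of_subset_left hsub2 hS.symm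
  obtain ⟨hset1, hsub1⟩ := wordSet_union w₁ h1 ha hXS
  have hcoef1 := wordCoeff_union w₁ h1 ha hXS
  unfold diagCoeff
  rw [wordSet_append, wordCoeff_append, Finset.union_comm a b, hset2, Finset.union_comm _ a, hset1,
    hcoef2, hcoef1, Finset.union_comm b a]
  have hiff := union_eq_union_iff_of_subset hsub1 ha hsub2 hb hS
  by_cases hfix1 : wordSet w₁ a = a
  · by_cases hfix2 : wordSet w₂ b = b
    · rw [if_pos (hiff.2 ⟨hfix1, hfix2⟩), if_pos hfix1, if_pos hfix2, hfix2]
      by_cases hz1 : wordCoeff w₁ a = 0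
      · rw [hz1]; ring
      by_cases hz2 : wordCoeff w₂ b = 0
      · rw [hz2]; ring
      rw [extSign_eq_one_of_wordSet_eq w₁ h1 hfix1 hz1, extSign_eq_one_of_wordSet_eq w₂ h2 hfix2 hz2]
      ring
    · rw [if_neg (fun h => hfix2 (hiff.1 h).2), if_neg hfix2]; ring
  · rw [if_neg (fun h => hfix1 (hiff.1 h).1), if_neg hfix1]; ring

omit [LinearOrder ι] [Fintype ι] in
/-- Subsets of a disjoint union correspond to pairs of subsets. [folklore] -/
theorem sum_powerset_union_eq_sum_sum [DecidableEq ι] {S₁ S₂ : Finset ι} (hS : Disjoint S₁ S₂)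
    (g : Finset ι → ℂ) :
    ∑ c ∈ (S₁ ∪ S₂).powerset, g c = ∑ a ∈ S₁.powerset, ∑ b ∈ S₂.powerset, g (a ∪ b) := by
  rw [← Finset.sum_product']
  symm
  refine Finset.sum_nbij' (fun p => p.1 ∪ p.2) (fun c => (c ∩ S₁, c ∩ S₂)) ?_ ?_ ?_ ?_ ?_
  · intro p hp
    obtain ⟨h1, h2⟩ := Finset.mem_product.1 hp
    exact Finset.mem_powerset.2 (Finset.union_subset_union (Finset.mem_powerset.1 h1)
      (Finset.mem_powerset.1 h2))
  · intro c hc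
    exact Finset.mem_product.2 ⟨Finset.mem_powerset.2 Finset.inter_subset_right,
      Finset.mem_powerset.2 Finset.inter_subset_right⟩
  · intro p hp
    obtain ⟨h1, h2⟩ := Finset.mem_product.1 hp
    have h1' := Finset.mem_powerset.1 h1
    have h2' := Finset.mem_powerset.1 h2
    have hd1 : Disjoint p.2 S₁ := Finset.disjoint_of_subset_left h2' hS.symm
    have hd2 : Disjoint p.1 S₂ := Finset.disjoint_of_subset_left h1' hS
    ext <;> simp only
    · rw [Finset.union_inter_distrib_right, Finset.inter_eq_left.2 h1',
        Finset.disjoint_iff_inter_eq_empty.1 hd1, Finset.union_empty]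
    · rw [Finset.union_inter_distrib_right, Finset.inter_eq_left.2 h2',
        Finset.disjoint_iff_inter_eq_empty.1 hd2, Finset.empty_union]
  · intro c hc
    have hc' := Finset.mem_powerset.1 hc
    show c ∩ S₁ ∪ c ∩ S₂ = c
    rw [← Finset.inter_union_distrib_left, Finset.inter_eq_left.2 hc']
  · intro p _; rfl

/-- **Traces of products of words with disjoint supports factorise**:
`Tr(w₁ w₂) · 2^{|ι|} = Tr(w₁) · Tr(w₂)` (i.e. for the normalised trace `τ = Tr/2^{|ι|}`,
`τ(w₁ w₂) = τ(w₁) τ(w₂)`). [cite: Ueltschi1999, §2.1 (factorization property of quantum interactions)] -/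
theorem trace_wordOp_append (w₁ w₂ : List (JWLetter ι)) (h1 : LettersIn S₁ w₁) (h2 : LettersIn S₂ w₂)
    (hS : Disjoint S₁ S₂) :
    (wordOp (w₁ ++ w₂)).trace * 2 ^ Fintype.card ι = (wordOp w₁).trace * (wordOp w₂).trace := by
  have h12 : LettersIn (S₁ ∪ S₂) (w₁ ++ w₂) :=
    lettersIn_append.2 ⟨h1.mono Finset.subset_union_left, h2.mono Finset.subset_union_right⟩
  rw [trace_wordOp_eq _ h12, trace_wordOp_eq _ h1, trace_wordOp_eq _ h2,
    sum_powerset_union_eq_sum_sum hS, Finset.card_union_of_disjoint hS]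
  have hsum : ∑ a ∈ S₁.powerset, ∑ b ∈ S₂.powerset, diagCoeff (w₁ ++ w₂) (a ∪ b) =
      (∑ a ∈ S₁.powerset, diagCoeff w₁ a) * ∑ b ∈ S₂.powerset, diagCoeff w₂ b := by
    rw [Finset.sum_mul_sum]
    refine Finset.sum_congr rfl fun a ha => Finset.sum_congr rfl fun b hb => ?_
    exact diagCoeff_append w₁ w₂ h1 h2 hS (Finset.mem_powerset.1 ha) (Finset.mem_powerset.1 hb)
  rw [hsum]
  have hle : S₁.card + S₂.card ≤ Fintype.card ι := by
    rw [← Finset.card_union_of_disjoint hS]; exact Finset.card_le_univ _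
  have hexp : (2 : ℂ) ^ (Fintype.card ι - (S₁.card + S₂.card)) * 2 ^ Fintype.card ι =
      2 ^ (Fintype.card ι - S₁.card) * 2 ^ (Fintype.card ι - S₂.card) := by
    rw [← pow_add, ← pow_add]
    congr 1
    omega
  calc (2 : ℂ) ^ (Fintype.card ι - (S₁.card + S₂.card)) *
        ((∑ a ∈ S₁.powerset, diagCoeff w₁ a) * ∑ b ∈ S₂.powerset, diagCoeff w₂ b) * 2 ^ Fintype.card ι
      = ((2 : ℂ) ^ (Fintype.card ι - (S₁.card + S₂.card)) * 2 ^ Fintype.card ι) *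
          ((∑ a ∈ S₁.powerset, diagCoeff w₁ a) * ∑ b ∈ S₂.powerset, diagCoeff w₂ b) := by ring
    _ = _ := by rw [hexp]; ring

end Traces

/-! ### The CAR subalgebras of a set of orbitals -/

section Subalgebras

variable [Fintype ι]

/-- The Jordan–Wigner generators `{c_i, c†_i : i ∈ S}` of the orbital set `S`. [folklore] -/
def carGenerators (S : Finset ι) : Set (Matrix (Finset ι) (Finset ι) ℂ) :=
  {M | ∃ l : JWLetter ι, l.1 ∈ S ∧ letterOp l = M}

/-- **The CAR subalgebra of the orbital set `S`**: the (unital) subalgebra of Fock-space operators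
generated by `c_i, c†_i`, `i ∈ S` (Bratteli–Robinson II §5.2.2, `𝔄(Λ)` for `Λ = S`).
[cite: BratteliRobinsonII1997, §5.2.2] -/
def carSubalgebra (S : Finset ι) : Subalgebra ℂ (Matrix (Finset ι) (Finset ι) ℂ) :=
  Algebra.adjoin ℂ (carGenerators S)

/-- The products of two generators of `S` (generators of the even part). [folklore] -/
def carEvenGenerators (S : Finset ι) : Set (Matrix (Finset ι) (Finset ι) ℂ) :=
  {M | ∃ l l' : JWLetter ι, l.1 ∈ S ∧ l'.1 ∈ S ∧ letterOp l * letterOp l' = M}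

/-- **The even CAR subalgebra of `S`**: generated by the products of two generators
(it contains every even local Hamiltonian: densities `n_i = c†_i c_i`, hoppings `c†_i c_j`, and
their products). [cite: BratteliRobinsonII1997, §5.2.2 (even subalgebra)] -/
def carEvenSubalgebra (S : Finset ι) : Subalgebra ℂ (Matrix (Finset ι) (Finset ι) ℂ) :=
  Algebra.adjoin ℂ (carEvenGenerators S)

variable {S S₁ S₂ : Finset ι}

/-- Generators belong to the CAR subalgebra. [folklore] -/
theorem letterOp_mem_carSubalgebra {l : JWLetter ι} (hl : l.1 ∈ S) : letterOp l ∈ carSubalgebra S :=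
  Algebra.subset_adjoin ⟨l, hl, rfl⟩

/-- `c_i ∈ 𝔄(S)` for `i ∈ S`. [folklore] -/
theorem annihilation_mem_carSubalgebra {i : ι} (hi : i ∈ S) : annihilation i ∈ carSubalgebra S :=
  letterOp_mem_carSubalgebra (l := (i, false)) hi

/-- `c†_i ∈ 𝔄(S)` for `i ∈ S`. [folklore] -/
theorem creation_mem_carSubalgebra {i : ι} (hi : i ∈ S) : creation i ∈ carSubalgebra S :=
  letterOp_mem_carSubalgebra (l := (i, true)) hi

/-- Words with letters in `S` belong to `𝔄(S)`. [folklore] -/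
theorem wordOp_mem_carSubalgebra {w : List (JWLetter ι)} (hw : LettersIn S w) : wordOp w ∈ carSubalgebra S := by
  induction w with
  | nil => rw [wordOp_nil]; exact Subalgebra.one_mem _
  | cons l w ih =>
    rw [wordOp_cons]
    exact Subalgebra.mul_mem _ (letterOp_mem_carSubalgebra (lettersIn_cons.1 hw).1)
      (ih (lettersIn_cons.1 hw).2)

/-- The even subalgebra is contained in the CAR subalgebra. [folklore] -/
theorem carEvenSubalgebra_le_carSubalgebra (S : Finset ι) : carEvenSubalgebra S ≤ carSubalgebra S := by
  refine Algebra.adjoin_le ?_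
  rintro M ⟨l, l', hl, hl', rfl⟩
  exact Subalgebra.mul_mem _ (letterOp_mem_carSubalgebra hl) (letterOp_mem_carSubalgebra hl')

/-- `c†_i c_j` is even for `i, j ∈ S`. [folklore] -/
theorem creation_mul_annihilation_mem_carEvenSubalgebra {i j : ι} (hi : i ∈ S) (hj : j ∈ S) :
    creation i * annihilation j ∈ carEvenSubalgebra S :=
  Algebra.subset_adjoin ⟨(i, true), (j, false), hi, hj, rfl⟩

/-- The CAR subalgebras are monotone in the orbital set. [folklore] -/
theorem carSubalgebra_mono {S T : Finset ι} (hST : S ⊆ T) : carSubalgebra S ≤ carSubalgebra T :=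
  Algebra.adjoin_mono fun _ ⟨l, hl, h⟩ => ⟨l, hST hl, h⟩

/-- The even CAR subalgebras are monotone in the orbital set. [folklore] -/
theorem carEvenSubalgebra_mono {S T : Finset ι} (hST : S ⊆ T) : carEvenSubalgebra S ≤ carEvenSubalgebra T :=
  Algebra.adjoin_mono fun _ ⟨l, l', hl, hl', h⟩ => ⟨l, l', hST hl, hST hl', h⟩

/-- A product of generators of `S` is a word with letters in `S`. [folklore] -/
theorem exists_wordOp_of_forall_mem_carGenerators :
    ∀ L : List (Matrix (Finset ι) (Finset ι) ℂ), (∀ y ∈ L, y ∈ carGenerators S) →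
      ∃ w : List (JWLetter ι), LettersIn S w ∧ wordOp w = L.prod
  | [], _ => ⟨[], fun _ h => by simp at h, by simp⟩
  | y :: L, h => by
    obtain ⟨l, hl, hy⟩ := h y (List.mem_cons_self)
    obtain ⟨w, hw, hprod⟩ := exists_wordOp_of_forall_mem_carGenerators L fun z hz => h z (List.mem_cons_of_mem y hz)
    refine ⟨l :: w, lettersIn_cons.2 ⟨hl, hw⟩, ?_⟩
    rw [wordOp_cons, hprod, hy, List.prod_cons]

/-- **`𝔄(S)` is the linear span of the words with letters in `S`** (`Algebra.adjoin_eq_span`).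
[folklore] -/
theorem mem_span_wordOp_of_mem_carSubalgebra {a : Matrix (Finset ι) (Finset ι) ℂ} (ha : a ∈ carSubalgebra S) :
    a ∈ Submodule.span ℂ {M | ∃ w : List (JWLetter ι), LettersIn S w ∧ wordOp w = M} := by
  have ha' : a ∈ Subalgebra.toSubmodule (carSubalgebra S) := ha
  rw [carSubalgebra, Algebra.adjoin_eq_span] at ha'
  refine Submodule.span_mono ?_ ha'
  intro x hx
  obtain ⟨L, hL, rfl⟩ := Submonoid.exists_list_of_mem_closure hx
  obtain ⟨w, hw, hprod⟩ := exists_wordOp_of_forall_mem_carGenerators L hL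
  exact ⟨w, hw, hprod⟩

/-- **Trace factorisation over disjoint CAR subalgebras**: for `a ∈ 𝔄(S₁)`, `b ∈ 𝔄(S₂)` with
`S₁ ∩ S₂ = ∅`, `Tr(ab) · 2^{|ι|} = Tr(a) · Tr(b)`, i.e. the normalised trace is a product state
(Bratteli–Robinson II §5.2.2; Ueltschi 1999 §2.1). [cite: BratteliRobinsonII1997, §5.2.2 (product structure of the trace state on the CAR algebra)] -/
theorem trace_mul_of_mem_carSubalgebra {a b : Matrix (Finset ι) (Finset ι) ℂ} (ha : a ∈ carSubalgebra S₁)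
    (hb : b ∈ carSubalgebra S₂) (hS : Disjoint S₁ S₂) :
    (a * b).trace * 2 ^ Fintype.card ι = a.trace * b.trace := by
  have key : ∀ a ∈ Submodule.span ℂ {M | ∃ w : List (JWLetter ι), LettersIn S₁ w ∧ wordOp w = M},
      ∀ b ∈ Submodule.span ℂ {M | ∃ w : List (JWLetter ι), LettersIn S₂ w ∧ wordOp w = M},
        (a * b).trace * 2 ^ Fintype.card ι = a.trace * b.trace := by
    intro a ha
    refine Submodule.span_induction (p := fun a _ => ∀ b ∈ Submodule.span ℂ
      {M | ∃ w : List (JWLetter ι), LettersIn S₂ w ∧ wordOp w = M}, (a * b).trace * 2 ^ Fintype.card ι = a.trace * b.trace)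
      ?_ ?_ ?_ ?_ ha
    · rintro _ ⟨w₁, hw₁, rfl⟩ b hb
      refine Submodule.span_induction (p := fun b _ => (wordOp w₁ * b).trace * 2 ^ Fintype.card ι =
        (wordOp w₁).trace * b.trace) ?_ ?_ ?_ ?_ hb
      · rintro _ ⟨w₂, hw₂, rfl⟩
        rw [← wordOp_append]
        exact trace_wordOp_append w₁ w₂ hw₁ hw₂ hS
      · simp
      · intro x y _ _ hx hy
        rw [mul_add, trace_add, add_mul, hx, hy, trace_add, mul_add]
      · intro c x _ hx
        rw [mul_smul_comm, trace_smul, smul_mul_assoc, hx, trace_smul, mul_smul_comm]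
    · intro b _; simp
    · intro x y _ _ hx hy b hb
      rw [add_mul, trace_add, add_mul, hx b hb, hy b hb, trace_add, add_mul]
    · intro c x _ hx b hb
      rw [smul_mul_assoc, trace_smul, smul_mul_assoc, hx b hb, trace_smul, smul_mul_assoc]
  exact key a (mem_span_wordOp_of_mem_carSubalgebra ha) b (mem_span_wordOp_of_mem_carSubalgebra hb)

/-- Three-fold trace factorisation over pairwise disjoint CAR subalgebras. [cite: BratteliRobinsonII1997, §5.2.2] -/
theorem trace_mul_mul_of_mem_carSubalgebra {S₃ : Finset ι} {a b c : Matrix (Finset ι) (Finset ι) ℂ}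
    (ha : a ∈ carSubalgebra S₁) (hb : b ∈ carSubalgebra S₂) (hc : c ∈ carSubalgebra S₃)
    (h12 : Disjoint S₁ S₂) (h13 : Disjoint S₁ S₃) (h23 : Disjoint S₂ S₃) :
    (a * b * c).trace * (2 ^ Fintype.card ι) ^ 2 = a.trace * b.trace * c.trace := by
  have hbc : b * c ∈ carSubalgebra (S₂ ∪ S₃) :=
    Subalgebra.mul_mem _ (carSubalgebra_mono Finset.subset_union_left hb)
      (carSubalgebra_mono Finset.subset_union_right hc)
  have h1 := trace_mul_of_mem_carSubalgebra ha hbc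
    (Finset.disjoint_union_right.2 ⟨h12, h13⟩)
  have h2 := trace_mul_of_mem_carSubalgebra hb hc h23
  rw [mul_assoc a b c, pow_two, ← mul_assoc, h1, mul_assoc, h2, mul_assoc]

/-! ### Graded commutativity -/

/-- Generators at distinct orbitals anticommute (the CAR, discharged in the tree). [cite: BratteliRobinsonII1997, §5.2.2 (5.2.11)–(5.2.12)] -/
theorem letterOp_mul_letterOp_of_ne {l l' : JWLetter ι} (h : l.1 ≠ l'.1) :
    letterOp l * letterOp l' = -(letterOp l' * letterOp l) := by
  obtain ⟨i, b⟩ := l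
  obtain ⟨j, b'⟩ := l'
  simp only at h
  have hcc := creation_anticommute_holds (ι := ι) i j
  have haa := annihilation_anticommute_holds (ι := ι) i j
  have hac := annihilation_mul_creation_add_creation_mul_annihilation_holds (ι := ι) i j
  have hca := annihilation_mul_creation_add_creation_mul_annihilation_holds (ι := ι) j i
  rw [if_neg h] at hac
  rw [if_neg (Ne.symm h)] at hca
  cases b <;> cases b' <;> simp only [letterOp, if_true, if_false, Bool.false_eq_true]
  · exact eq_neg_of_add_eq_zero_left haa
  · exact eq_neg_of_add_eq_zero_left hac
  · exact eq_neg_of_add_eq_zero_left (by rw [add_comm]; exact hca)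
  · exact eq_neg_of_add_eq_zero_left hcc

/-- A product of two generators commutes with a generator at a different orbital. [folklore] -/
theorem commute_letterOp_mul_letterOp {l₁ l₂ l : JWLetter ι} (h1 : l₁.1 ≠ l.1) (h2 : l₂.1 ≠ l.1) :
    Commute (letterOp l₁ * letterOp l₂) (letterOp l) := by
  rw [Commute, SemiconjBy, mul_assoc, letterOp_mul_letterOp_of_ne h2, mul_neg, ← mul_assoc,
    letterOp_mul_letterOp_of_ne h1, neg_mul, neg_neg, mul_assoc]

/-- **Graded commutativity**: elements of the even CAR subalgebra of `S₁` commute with the whole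
CAR subalgebra of a disjoint `S₂`. [cite: BratteliRobinsonII1997, §5.2.2 (even elements of disjoint regions commute)] -/
theorem commute_of_mem_carEvenSubalgebra {a b : Matrix (Finset ι) (Finset ι) ℂ} (ha : a ∈ carEvenSubalgebra S₁)
    (hb : b ∈ carSubalgebra S₂) (hS : Disjoint S₁ S₂) : Commute a b := by
  -- step 1: even generators of `S₁` commute with `𝔄(S₂)`
  have step1 : carEvenGenerators S₁ ⊆ (Subalgebra.centralizer ℂ (carSubalgebra S₂ : Set (Matrix (Finset ι) (Finset ι) ℂ)) : Set (Matrix (Finset ι) (Finset ι) ℂ)) := by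
    rintro g ⟨l₁, l₂, hl₁, hl₂, rfl⟩
    rw [SetLike.mem_coe, Subalgebra.mem_centralizer_iff]
    intro b' hb'
    -- `𝔄(S₂) ≤ centralizer {g}`
    have hle : carSubalgebra S₂ ≤ Subalgebra.centralizer ℂ {letterOp l₁ * letterOp l₂} := by
      refine Algebra.adjoin_le ?_
      rintro _ ⟨l, hl, rfl⟩
      rw [SetLike.mem_coe, Subalgebra.mem_centralizer_iff]
      intro g hg
      rw [Set.mem_singleton_iff] at hg
      subst hg
      have hne1 : l₁.1 ≠ l.1 := fun h => Finset.disjoint_left.1 hS hl₁ (h ▸ hl)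
      have hne2 : l₂.1 ≠ l.1 := fun h => Finset.disjoint_left.1 hS hl₂ (h ▸ hl)
      exact (commute_letterOp_mul_letterOp hne1 hne2).eq
    have := (Subalgebra.mem_centralizer_iff ℂ).1 (hle hb') _ (Set.mem_singleton _)
    exact this.symm
  -- step 2: hence the even subalgebra lies in the centraliser
  have step2 : carEvenSubalgebra S₁ ≤ Subalgebra.centralizer ℂ (carSubalgebra S₂ : Set (Matrix (Finset ι) (Finset ι) ℂ)) :=
    Algebra.adjoin_le step1
  have := (Subalgebra.mem_centralizer_iff ℂ).1 (step2 ha) b hb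
  exact this.symm

/-! ### Exponentials stay in the subalgebras -/

open scoped Matrix.Norms.L2Operator in
/-- A subalgebra of the (finite-dimensional) matrix algebra is closed under the exponential
(partial sums of the exponential series lie in the subalgebra, which is a closed subspace).
[folklore] -/
theorem exp_mem_subalgebra (A : Subalgebra ℂ (Matrix (Finset ι) (Finset ι) ℂ))
    {X : Matrix (Finset ι) (Finset ι) ℂ} (hX : X ∈ A) : NormedSpace.exp X ∈ A := by
  have hclosed : IsClosed ((Subalgebra.toSubmodule A : Submodule ℂ _) : Set (Matrix (Finset ι) (Finset ι) ℂ)) :=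
    Submodule.closed_of_finiteDimensional _
  have hsum := (NormedSpace.exp_series_hasSum_exp' (𝕂 := ℂ) X).tendsto_sum_nat
  refine hclosed.mem_of_tendsto hsum (Filter.Eventually.of_forall fun n => ?_)
  exact Submodule.sum_mem _ fun k _ => Submodule.smul_mem _ _ (Subalgebra.pow_mem A hX k)

end Subalgebras

end Literature.MathematicalPhysics.QuantumLattice
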